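import Summits.Ventures.LatticeQCDFlow.Exactness.Phi4HMCReversible
import Summits.Ventures.LatticeQCDFlow.Exactness.FlowSamplerAutocorrelation
import Summits.Ventures.LatticeQCDFlow.Scoring.CalibrationTruths
import HarnessLib

/-!
# `τ_int ≥ (1 + ρ(1))/(2(1 − ρ(1)))` for EVERY REVERSIBLE sampler — general state space, no spectral theorem

HONEST FRAMING: exact (Metropolis-corrected) sampling algorithms for lattice gauge theory;
figures of merit are autocorrelation/cost numbers at stated couplings and volumes; no
continuum-physics claim.  (SCALAR calibration rung S0-A: not a gauge result.)

Venture `LatticeQCDFlow` (cell pub-lqcd), topic `Exactness`; FANOUT row 2 (`s0-phi4`: all three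
S0-A sampler families — flow/IMH, HMC, local Metropolis — are REVERSIBLE, typed in
`Phi4IndependenceSamplerReversible`, `Phi4HMCReversible`, `Phi4LocalMetropolisReversible`).
NEW WORK of the cell over Mathlib, row 2's weighted Cauchy–Schwarz
(`FlowSamplerAutocorrelation.sq_integral_mul_mul_le`) and the cell's `τ_int` vocabulary
(`Scoring/CalibrationTruths.tauInt`).  Nothing is cited as a fact.  Printed counterpart, NAMED
ONLY: Madras–Slade 1993, *The Self-Avoiding Walk*, Prop. 9.2.2 (p. 304; proof §9.7.1 by the
spectral theorem, finite state space): for a reversible chain and any nonconstant `g ∈ ℓ²(π)`,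
`τ_int,g ≥ ½(1 + ρ_g(1))/(1 − ρ_g(1))`.  HERE: an arbitrary measure space and an ELEMENTARY proof —
the spectral theorem is replaced by "pair positivity" `‖Kᵐh‖² + ⟨Kᵐh, K Kᵐh⟩ ≥ 0` (Cauchy–Schwarz
+ contraction) applied to the test observable `h = K g − ρ(1) g`, which is exactly the tangent-line
form of Jensen's inequality for the convex function `λ ↦ (1 + λ)/(1 − λ)`.

## Setting (abstract; instantiated for row 2's samplers in `Exactness/Phi4SamplersTauIntFloor.lean`)

`(X, μ)` a measurable space with a measure, `w > 0` an integrable weight (the target `e^{−S}`),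
`K : (X → ℝ) → (X → ℝ)` an operator on observables with four properties, each an explicit
hypothesis: (bdd) `K` maps "measurable and `|·| ≤ B`" to itself; (lin) `K(f + c h) = K f + c K h`;
(symm) `∫ (K f) h w = ∫ f (K h) w` (detailed balance, integrated form); (contr)
`∫ (K f)² w ≤ ∫ f² w` (every exact Markov operator: Jensen + invariance).

## What is proved

* `op_iterate_bdd`, `op_iterate_add_mul`, `op_two_time` (`∫ (Kᵐg)(Kᵏg) w = C(m+k)`,
  `C(n) = ∫ g (Kⁿ g) w`);
* **`op_pair_nonneg`** `0 ≤ C_h(2m) + C_h(2m+1)` for every bounded measurable `h`;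
  `op_partial_sum_nonneg` (`0 ≤ Σ_{n<2N} C_h(n)`); **`op_tsum_nonneg`** (summable ⇒
  `0 ≤ Σ_{n≥0} C_h(n)`, the resolvent form `⟨h, (1 − K)⁻¹ h⟩ ≥ 0` without operator theory);
* **`reversible_tauInt_ge`** — for every bounded measurable `g` whose normalised autocorrelation
  `ρ(n) = C(n)/∫ g² w` has a summable tail and `ρ(1) < 1`:
  `(1 + ρ(1))/(2(1 − ρ(1))) ≤ τ_int = ½ + Σ_{n≥1} ρ(n)`
  (with `h = K g − ρ(1) g`: `Σ_n C_h(n) = (1 − ρ)(S(1 − ρ) − C(1))`, `S = Σ_{n≥1} C(n)`).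

Reading for S0-A (no numerics implied): for HMC and local Metropolis as much as for the flow
sampler, a measured lag-one autocorrelation `ρ̂(1)` of any observable certifies the floor
`τ_int ≥ (1 + ρ(1))/(2(1 − ρ(1)))`, i.e. ESS per sample `≤ (1 − ρ(1))/(1 + ρ(1))` — the geometric
(AR(1)) value is the BEST case compatible with a given `ρ(1)`.  Unlike the flow sampler
(`FlowSamplerTauIntFloor`: all `ρ(n) ≥ 0`, monotone windows), a general reversible sampler may have
negative autocorrelations, and `ρ(1) < 0` makes the floor drop below `½`.
NOT CLAIMED: `ρ(1) < 1` or summability for any particular sampler (hypotheses here; both hold under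
a spectral gap); non-reversible updates (ordered sweeps); unbounded observables.
-/

namespace Summit.Ventures.LatticeQCDFlow.Exactness

open Real MeasureTheory Filter Finset
open Summit.Ventures.LatticeQCDFlow.Scoring

section Reversible

variable {X : Type*} [MeasurableSpace X] {μ : Measure X} {w : X → ℝ} {K : (X → ℝ) → (X → ℝ)}

/-- Iterates of an operator that preserves "measurable and bounded by `B`" do so as well. -/
theorem op_iterate_bdd
    (hbdd : ∀ ⦃f : X → ℝ⦄ ⦃B : ℝ⦄, Measurable f → (∀ x, |f x| ≤ B) →
      Measurable (K f) ∧ ∀ x, |K f x| ≤ B) {B : ℝ} :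
    ∀ (n : ℕ) {f : X → ℝ}, Measurable f → (∀ x, |f x| ≤ B) →
      Measurable (K^[n] f) ∧ ∀ x, |(K^[n] f) x| ≤ B
  | 0, f, hfm, hfb => by simpa using ⟨hfm, hfb⟩
  | n + 1, f, hfm, hfb => by
    rw [Function.iterate_succ_apply]
    obtain ⟨h1, h2⟩ := hbdd hfm hfb
    exact op_iterate_bdd hbdd n h1 h2

/-- Iterates of a linear operator are linear: `Kⁿ(f + c h) = Kⁿ f + c Kⁿ h`. -/
theorem op_iterate_add_mul
    (hbdd : ∀ ⦃f : X → ℝ⦄ ⦃B : ℝ⦄, Measurable f → (∀ x, |f x| ≤ B) →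
      Measurable (K f) ∧ ∀ x, |K f x| ≤ B)
    (hlin : ∀ ⦃f h : X → ℝ⦄ ⦃Bf Bh : ℝ⦄ (c : ℝ), Measurable f → Measurable h →
      (∀ x, |f x| ≤ Bf) → (∀ x, |h x| ≤ Bh) → ∀ x, K (fun s => f s + c * h s) x = K f x + c * K h x)
    {Bf Bh : ℝ} (c : ℝ) :
    ∀ (n : ℕ) {f h : X → ℝ}, Measurable f → Measurable h → (∀ x, |f x| ≤ Bf) →
      (∀ x, |h x| ≤ Bh) → ∀ x, (K^[n] (fun s => f s + c * h s)) x = (K^[n] f) x + c * (K^[n] h) x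
  | 0, f, h, _, _, _, _ => by simp
  | n + 1, f, h, hfm, hhm, hfb, hhb => by
    intro x
    have e : K (fun s => f s + c * h s) = fun s => K f s + c * K h s := funext (hlin c hfm hhm hfb hhb)
    rw [Function.iterate_succ_apply, Function.iterate_succ_apply, Function.iterate_succ_apply, e]
    obtain ⟨h1, h2⟩ := hbdd hfm hfb
    obtain ⟨h3, h4⟩ := hbdd hhm hhb
    exact op_iterate_add_mul hbdd hlin c n h1 h3 h2 h4 x

/-- **Two-time form** of a self-adjoint operator: `∫ (Kᵐ g)(Kᵏ g) w = ∫ g (K^{m+k} g) w`. -/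
theorem op_two_time
    (hbdd : ∀ ⦃f : X → ℝ⦄ ⦃B : ℝ⦄, Measurable f → (∀ x, |f x| ≤ B) →
      Measurable (K f) ∧ ∀ x, |K f x| ≤ B)
    (hsymm : ∀ ⦃f h : X → ℝ⦄ ⦃Bf Bh : ℝ⦄, Measurable f → Measurable h → (∀ x, |f x| ≤ Bf) →
      (∀ x, |h x| ≤ Bh) → ∫ x, K f x * h x * w x ∂μ = ∫ x, f x * K h x * w x ∂μ)
    {g : X → ℝ} (hgm : Measurable g) {B : ℝ} (hgb : ∀ x, |g x| ≤ B) :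
    ∀ m k : ℕ, ∫ x, (K^[m] g) x * (K^[k] g) x * w x ∂μ = ∫ x, g x * (K^[m + k] g) x * w x ∂μ
  | 0, k => by simp
  | m + 1, k => by
    obtain ⟨hmm, hmb⟩ := op_iterate_bdd hbdd m hgm hgb
    obtain ⟨hkm, hkb⟩ := op_iterate_bdd hbdd k hgm hgb
    rw [Function.iterate_succ_apply' K m g, hsymm hmm hkm hmb hkb,
      ← Function.iterate_succ_apply' K k g, op_two_time hbdd hsymm hgm hgb m (k + 1),
      Nat.add_right_comm m 1 k, Nat.add_assoc]

/-- **PAIR POSITIVITY** — the elementary substitute for the spectral theorem: for a self-adjoint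
`L²(w)`-contraction and every bounded measurable `h`, consecutive even/odd lags pair up
nonnegatively: `0 ≤ ∫ h (K^{2m} h) w + ∫ h (K^{2m+1} h) w`
(`= ‖Kᵐh‖² + ⟨Kᵐh, K Kᵐh⟩ ≥ ‖Kᵐh‖² − ‖Kᵐh‖·‖K^{m+1}h‖ ≥ 0`). -/
theorem op_pair_nonneg (hw0 : ∀ x, 0 < w x) (hwm : Measurable w) (hwi : Integrable w μ)
    (hbdd : ∀ ⦃f : X → ℝ⦄ ⦃B : ℝ⦄, Measurable f → (∀ x, |f x| ≤ B) →
      Measurable (K f) ∧ ∀ x, |K f x| ≤ B)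
    (hsymm : ∀ ⦃f h : X → ℝ⦄ ⦃Bf Bh : ℝ⦄, Measurable f → Measurable h → (∀ x, |f x| ≤ Bf) →
      (∀ x, |h x| ≤ Bh) → ∫ x, K f x * h x * w x ∂μ = ∫ x, f x * K h x * w x ∂μ)
    (hcontr : ∀ ⦃f : X → ℝ⦄ ⦃B : ℝ⦄, Measurable f → (∀ x, |f x| ≤ B) →
      ∫ x, K f x ^ 2 * w x ∂μ ≤ ∫ x, f x ^ 2 * w x ∂μ)
    {h : X → ℝ} (hhm : Measurable h) {B : ℝ} (hhb : ∀ x, |h x| ≤ B) (m : ℕ) :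
    0 ≤ (∫ x, h x * (K^[2 * m] h) x * w x ∂μ) + ∫ x, h x * (K^[2 * m + 1] h) x * w x ∂μ := by
  obtain ⟨hum, hub⟩ := op_iterate_bdd hbdd m hhm hhb
  obtain ⟨hvm, hvb⟩ := hbdd hum hub
  rw [two_mul, ← op_two_time hbdd hsymm hhm hhb m m,
    show m + m + 1 = m + (m + 1) by ring, ← op_two_time hbdd hsymm hhm hhb m (m + 1),
    Function.iterate_succ_apply' K m h]
  set u := K^[m] h with hu
  -- `A = ∫ u² w`, `A' = ∫ (K u)² w ≤ A`, `(∫ u (K u) w)² ≤ A A' ≤ A²`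
  have hA0 : 0 ≤ ∫ x, u x ^ 2 * w x ∂μ := integral_nonneg fun x => mul_nonneg (sq_nonneg _) (hw0 x).le
  have hA' := hcontr hum hub
  have hCS := sq_integral_mul_mul_le hw0 hwm hwi hum hvm hub hvb
  have hsq : (∫ x, u x * K u x * w x ∂μ) ^ 2 ≤ (∫ x, u x ^ 2 * w x ∂μ) ^ 2 := by
    calc (∫ x, u x * K u x * w x ∂μ) ^ 2
        ≤ (∫ x, u x ^ 2 * w x ∂μ) * ∫ x, K u x ^ 2 * w x ∂μ := hCS
      _ ≤ (∫ x, u x ^ 2 * w x ∂μ) * ∫ x, u x ^ 2 * w x ∂μ := mul_le_mul_of_nonneg_left hA' hA0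
      _ = (∫ x, u x ^ 2 * w x ∂μ) ^ 2 := by ring
  have habs := abs_le_of_sq_le_sq' hsq hA0
  have e : ∫ x, u x * u x * w x ∂μ = ∫ x, u x ^ 2 * w x ∂μ := by simp only [sq]
  rw [e]
  linarith [habs.1]

/-- Partial sums over whole pairs are nonnegative: `0 ≤ Σ_{n < 2N} ∫ h (Kⁿ h) w`. -/
theorem op_partial_sum_nonneg (hw0 : ∀ x, 0 < w x) (hwm : Measurable w) (hwi : Integrable w μ)
    (hbdd : ∀ ⦃f : X → ℝ⦄ ⦃B : ℝ⦄, Measurable f → (∀ x, |f x| ≤ B) →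
      Measurable (K f) ∧ ∀ x, |K f x| ≤ B)
    (hsymm : ∀ ⦃f h : X → ℝ⦄ ⦃Bf Bh : ℝ⦄, Measurable f → Measurable h → (∀ x, |f x| ≤ Bf) →
      (∀ x, |h x| ≤ Bh) → ∫ x, K f x * h x * w x ∂μ = ∫ x, f x * K h x * w x ∂μ)
    (hcontr : ∀ ⦃f : X → ℝ⦄ ⦃B : ℝ⦄, Measurable f → (∀ x, |f x| ≤ B) →
      ∫ x, K f x ^ 2 * w x ∂μ ≤ ∫ x, f x ^ 2 * w x ∂μ)
    {h : X → ℝ} (hhm : Measurable h) {B : ℝ} (hhb : ∀ x, |h x| ≤ B) :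
    ∀ N : ℕ, 0 ≤ ∑ n ∈ Finset.range (2 * N), ∫ x, h x * (K^[n] h) x * w x ∂μ
  | 0 => by simp
  | N + 1 => by
    rw [show 2 * (N + 1) = 2 * N + 1 + 1 by ring, Finset.sum_range_succ, Finset.sum_range_succ]
    have h1 := op_partial_sum_nonneg hw0 hwm hwi hbdd hsymm hcontr hhm hhb N
    have h2 := op_pair_nonneg hw0 hwm hwi hbdd hsymm hcontr hhm hhb N
    linarith

/-- **The resolvent form is nonnegative**: if `n ↦ ∫ h (Kⁿ h) w` is summable then
`0 ≤ Σ_{n ≥ 0} ∫ h (Kⁿ h) w` (`= ⟨h, (1 − K)⁻¹ h⟩` when that makes sense). -/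
theorem op_tsum_nonneg (hw0 : ∀ x, 0 < w x) (hwm : Measurable w) (hwi : Integrable w μ)
    (hbdd : ∀ ⦃f : X → ℝ⦄ ⦃B : ℝ⦄, Measurable f → (∀ x, |f x| ≤ B) →
      Measurable (K f) ∧ ∀ x, |K f x| ≤ B)
    (hsymm : ∀ ⦃f h : X → ℝ⦄ ⦃Bf Bh : ℝ⦄, Measurable f → Measurable h → (∀ x, |f x| ≤ Bf) →
      (∀ x, |h x| ≤ Bh) → ∫ x, K f x * h x * w x ∂μ = ∫ x, f x * K h x * w x ∂μ)
    (hcontr : ∀ ⦃f : X → ℝ⦄ ⦃B : ℝ⦄, Measurable f → (∀ x, |f x| ≤ B) →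
      ∫ x, K f x ^ 2 * w x ∂μ ≤ ∫ x, f x ^ 2 * w x ∂μ)
    {h : X → ℝ} (hhm : Measurable h) {B : ℝ} (hhb : ∀ x, |h x| ≤ B)
    (hs : Summable fun n => ∫ x, h x * (K^[n] h) x * w x ∂μ) :
    0 ≤ ∑' n, ∫ x, h x * (K^[n] h) x * w x ∂μ := by
  have ht := hs.hasSum.tendsto_sum_nat
  have h2 : Tendsto (fun N : ℕ => 2 * N) atTop atTop :=
    tendsto_atTop_mono (fun N => Nat.le_mul_of_pos_left N two_pos) tendsto_id
  exact ge_of_tendsto' (ht.comp h2)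
    fun N => op_partial_sum_nonneg hw0 hwm hwi hbdd hsymm hcontr hhm hhb N

/-- **THE `τ_int` FLOOR FOR A REVERSIBLE SAMPLER (Madras–Slade Prop. 9.2.2, general state space,
elementary).**  `K` linear, bounded-measurable-preserving, self-adjoint on `L²(w dμ)` and an
`L²(w)`-contraction; `g` bounded measurable with `C(n) = ∫ g (Kⁿ g) w`, `ρ(n) = C(n)/C(0)`.
If the autocorrelation series is summable and `ρ(1) < 1`, then
`τ_int = ½ + Σ_{n≥1} ρ(n) ≥ (1 + ρ(1))/(2(1 − ρ(1)))`.
Proof: apply `op_tsum_nonneg` to `h = K g − ρ(1) g`: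
`0 ≤ Σ_n ⟨h, Kⁿ h⟩ = S(1 − ρ)² − C(1)(1 − ρ)` with `S = Σ_{n≥1} C(n)`. -/
theorem reversible_tauInt_ge (hw0 : ∀ x, 0 < w x) (hwm : Measurable w) (hwi : Integrable w μ)
    (hbdd : ∀ ⦃f : X → ℝ⦄ ⦃B : ℝ⦄, Measurable f → (∀ x, |f x| ≤ B) →
      Measurable (K f) ∧ ∀ x, |K f x| ≤ B)
    (hlin : ∀ ⦃f h : X → ℝ⦄ ⦃Bf Bh : ℝ⦄ (c : ℝ), Measurable f → Measurable h →
      (∀ x, |f x| ≤ Bf) → (∀ x, |h x| ≤ Bh) → ∀ x, K (fun s => f s + c * h s) x = K f x + c * K h x)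
    (hsymm : ∀ ⦃f h : X → ℝ⦄ ⦃Bf Bh : ℝ⦄, Measurable f → Measurable h → (∀ x, |f x| ≤ Bf) →
      (∀ x, |h x| ≤ Bh) → ∫ x, K f x * h x * w x ∂μ = ∫ x, f x * K h x * w x ∂μ)
    (hcontr : ∀ ⦃f : X → ℝ⦄ ⦃B : ℝ⦄, Measurable f → (∀ x, |f x| ≤ B) →
      ∫ x, K f x ^ 2 * w x ∂μ ≤ ∫ x, f x ^ 2 * w x ∂μ)
    {g : X → ℝ} (hgm : Measurable g) {B : ℝ} (hgb : ∀ x, |g x| ≤ B)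
    (hs : Summable fun n => (∫ x, g x * (K^[n + 1] g) x * w x ∂μ) / ∫ x, g x ^ 2 * w x ∂μ)
    (hρ : (∫ x, g x * K g x * w x ∂μ) / (∫ x, g x ^ 2 * w x ∂μ) < 1) :
    (1 + (∫ x, g x * K g x * w x ∂μ) / ∫ x, g x ^ 2 * w x ∂μ)
        / (2 * (1 - (∫ x, g x * K g x * w x ∂μ) / ∫ x, g x ^ 2 * w x ∂μ))
      ≤ tauInt (fun n => (∫ x, g x * (K^[n] g) x * w x ∂μ) / ∫ x, g x ^ 2 * w x ∂μ) := by
  -- notation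
  set a : ℕ → ℝ := fun n => ∫ x, g x * (K^[n] g) x * w x ∂μ with ha
  set A := ∫ x, g x ^ 2 * w x ∂μ with hA
  set ρ := (∫ x, g x * K g x * w x ∂μ) / A with hρdef
  have hA0 : 0 ≤ A := integral_nonneg fun x => mul_nonneg (sq_nonneg _) (hw0 x).le
  have ha0 : a 0 = A := by simp only [ha, hA, Function.iterate_zero, id_eq, sq]
  have ha1 : a 1 = ∫ x, g x * K g x * w x ∂μ := by simp only [ha, Function.iterate_one]
  have two := op_two_time hbdd hsymm hgm hgb
  -- the test observable `h = K g − ρ g`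
  obtain ⟨hKm, hKb⟩ := hbdd hgm hgb
  set h : X → ℝ := fun s => K g s + (-ρ) * g s with hh
  have hhm : Measurable h := hKm.add (measurable_const.mul hgm)
  have hhb : ∀ x, |h x| ≤ B + |ρ| * B := fun x => by
    calc |K g x + (-ρ) * g x| ≤ |K g x| + |(-ρ) * g x| := abs_add_le _ _
      _ ≤ B + |ρ| * B := by
          rw [abs_mul, abs_neg]
          exact add_le_add (hKb x) (mul_le_mul_of_nonneg_left (hgb x) (abs_nonneg ρ))
  -- `∫ h (Kⁿ h) w = a(n+2) − 2ρ a(n+1) + ρ² a(n)`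
  have hb : ∀ n, ∫ x, h x * (K^[n] h) x * w x ∂μ = a (n + 2) - 2 * ρ * a (n + 1) + ρ ^ 2 * a n := by
    intro n
    obtain ⟨hn_m, hn_b⟩ := op_iterate_bdd hbdd n hgm hgb
    obtain ⟨hn1_m, hn1_b⟩ := op_iterate_bdd hbdd (n + 1) hgm hgb
    have hlinn := op_iterate_add_mul hbdd hlin (-ρ) n hKm hgm hKb hgb
    have e : ∀ x, h x * (K^[n] h) x * w x
        = K g x * (K^[n + 1] g) x * w x + (-ρ) * (K g x * (K^[n] g) x * w x)
          + (-ρ) * (g x * (K^[n + 1] g) x * w x) + ρ ^ 2 * (g x * (K^[n] g) x * w x) := by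
      intro x
      rw [hlinn x, ← Function.iterate_succ_apply K n g]
      simp only [hh]
      ring
    rw [integral_congr_ae (Eventually.of_forall e)]
    have ibw : ∀ {u v : X → ℝ}, Measurable u → Measurable v → (∀ x, |u x| ≤ B) →
        (∀ x, |v x| ≤ B) → Integrable (fun x => u x * v x * w x) μ := by
      intro u v hum hvm hub hvb
      refine integrable_bdd_mul_weight (hum.mul hvm) (C := B * B) ?_ hwm (fun x => (hw0 x).le) hwi
      intro z
      show |u z * v z| ≤ B * B
      rw [abs_mul]
      exact mul_le_mul (hub z) (hvb z) (abs_nonneg _) ((abs_nonneg _).trans (hub z))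
    have i1 : Integrable (fun x => K g x * (K^[n + 1] g) x * w x) μ := ibw hKm hn1_m hKb hn1_b
    have i2 : Integrable (fun x => (-ρ) * (K g x * (K^[n] g) x * w x)) μ :=
      (ibw hKm hn_m hKb hn_b).const_mul _
    have i3 : Integrable (fun x => (-ρ) * (g x * (K^[n + 1] g) x * w x)) μ :=
      (ibw hgm hn1_m hgb hn1_b).const_mul _
    have i4 : Integrable (fun x => ρ ^ 2 * (g x * (K^[n] g) x * w x)) μ :=
      (ibw hgm hn_m hgb hn_b).const_mul _
    have i12 : Integrable (fun x => K g x * (K^[n + 1] g) x * w x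
        + (-ρ) * (K g x * (K^[n] g) x * w x)) μ := i1.add i2
    have i123 : Integrable (fun x => K g x * (K^[n + 1] g) x * w x
        + (-ρ) * (K g x * (K^[n] g) x * w x) + (-ρ) * (g x * (K^[n + 1] g) x * w x)) μ := i12.add i3
    rw [integral_add i123 i4, integral_add i12 i3, integral_add i1 i2, integral_const_mul,
      integral_const_mul, integral_const_mul]
    -- identify the four integrals with `a` values via the two-time form (`K g = K^[1] g`)
    have e1 : ∫ x, K g x * (K^[n + 1] g) x * w x ∂μ = a (n + 2) := by
      have := two 1 (n + 1)
      simp only [Function.iterate_one] at this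
      rw [this, show 1 + (n + 1) = n + 2 by ring]
    have e2 : ∫ x, K g x * (K^[n] g) x * w x ∂μ = a (n + 1) := by
      have := two 1 n
      simp only [Function.iterate_one] at this
      rw [this, show 1 + n = n + 1 by ring]
    rw [e1, e2]
    simp only [ha]
    ring
  -- summability of the `a`-tail and of `b`
  have hsa : Summable fun n => a (n + 1) := by
    rcases eq_or_lt_of_le hA0 with hz | hpos
    · -- `A = 0`: `g = 0` in `L²(w)`, every `a n = 0`
      have hg2 : ∫ x, g x ^ 2 * w x ∂μ = 0 := hz.symm
      have hzero : ∀ n, a (n + 1) = 0 := by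
        intro n
        obtain ⟨hn_m, hn_b⟩ := op_iterate_bdd hbdd (n + 1) hgm hgb
        have hcs := sq_integral_mul_mul_le hw0 hwm hwi hgm hn_m hgb hn_b
        rw [hg2, zero_mul] at hcs
        exact pow_eq_zero_iff (n := 2) (by norm_num) |>.1 (le_antisymm hcs (sq_nonneg _))
      exact summable_zero.congr fun n => (hzero n).symm
    · have := hs.mul_left A
      refine this.congr fun n => ?_
      simp only [ha]
      field_simp
  have hsb : Summable fun n => ∫ x, h x * (K^[n] h) x * w x ∂μ := by
    simp_rw [hb]
    have h2 : Summable fun n => a (n + 2) := (summable_nat_add_iff 1).2 hsa |>.congr fun n => by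
      simp only [Nat.add_assoc]
    have h0 : Summable fun n => a n := (summable_nat_add_iff 1).1 hsa
    exact (h2.sub (hsa.mul_left (2 * ρ))).add (h0.mul_left (ρ ^ 2))
  -- `0 ≤ Σ b = (S − a 1) − 2ρ S + ρ² (a 0 + S)`, `S = Σ_{n≥0} a(n+1)`
  have hpos := op_tsum_nonneg hw0 hwm hwi hbdd hsymm hcontr hhm hhb hsb
  set S := ∑' n, a (n + 1) with hS
  have hS2 : ∑' n, a (n + 2) = S - a 1 := by
    have := hsa.sum_add_tsum_nat_add 1
    simp only [Finset.sum_range_one] at this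
    rw [hS, ← this]
    ring_nf
  have hS0 : ∑' n, a n = a 0 + S := by
    have h0 : Summable fun n => a n := (summable_nat_add_iff 1).1 hsa
    have := h0.sum_add_tsum_nat_add 1
    simp only [Finset.sum_range_one] at this
    rw [hS, ← this]
  have hsum_b : ∑' n, ∫ x, h x * (K^[n] h) x * w x ∂μ = (S - a 1) - 2 * ρ * S + ρ ^ 2 * (a 0 + S) := by
    simp_rw [hb]
    have h2 : Summable fun n => a (n + 2) := (summable_nat_add_iff 1).2 hsa |>.congr fun n => by
      simp only [Nat.add_assoc]
    have h0 : Summable fun n => a n := (summable_nat_add_iff 1).1 hsa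
    rw [(h2.sub (hsa.mul_left (2 * ρ))).tsum_add (h0.mul_left (ρ ^ 2)),
      h2.tsum_sub (hsa.mul_left (2 * ρ)), tsum_mul_left, tsum_mul_left, hS2, hS0]
  rw [hsum_b] at hpos
  -- `τ_int = ½ + S/A`
  have htau : tauInt (fun n => (∫ x, g x * (K^[n] g) x * w x ∂μ) / ∫ x, g x ^ 2 * w x ∂μ)
      = 1 / 2 + S / A := by
    simp only [tauInt]
    rw [tsum_div_const]
  rw [htau]
  rcases eq_or_lt_of_le hA0 with hz | hApos
  · -- degenerate `A = 0`: `ρ = 0`, `S/A = 0`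
    have hρ0 : ρ = 0 := by rw [hρdef, ← hz, div_zero]
    rw [hρ0, ← hz, div_zero]
    norm_num
  · have hρA : ρ * A = a 1 := by
      rw [hρdef, ha1]
      field_simp
    have e1 : S - a 1 - 2 * ρ * S + ρ ^ 2 * (a 0 + S) = (1 - ρ) * (S * (1 - ρ) - a 1) := by
      rw [ha0]
      have : ρ ^ 2 * A = ρ * a 1 := by rw [← hρA]; ring
      linear_combination this
    rw [e1] at hpos
    have h1ρ : 0 < 1 - ρ := by linarith
    have hkey : 0 ≤ S * (1 - ρ) - a 1 := (mul_nonneg_iff_of_pos_left h1ρ).1 hpos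
    -- `ρ/(1 − ρ) ≤ S/A`
    have hSA : ρ / (1 - ρ) ≤ S / A := by
      rw [div_le_div_iff₀ h1ρ hApos]
      nlinarith [hρA, hkey]
    have e2 : (1 + ρ) / (2 * (1 - ρ)) = 1 / 2 + ρ / (1 - ρ) := by
      field_simp
      ring
    rw [e2]
    linarith

end Reversible

end Summit.Ventures.LatticeQCDFlow.Exactness
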